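import Summits.ValiantsHypothesis.ValiantsHypothesis.Theses.RealTau
import Literature.Computability.AlgebraicComplexity.RealTauKnownCases

/-!
# `RealTau.RealTauRefined` (stmt-ValiantsHypothesis-18101) — negative side: load-bearing ingredients

Refuter (crux attack at birth, 2026-08-17), from `Cruxes/RealTauRefined/Disproof.lean` §(a)–(c),(e).
The crux is Tavenas 2014, Conj. 3.23 (refined real τ-conjecture) in the normal form
`#Z_ℝ(∑_{i<k} ∏_{j<m} f_ij) ≤ 2^(a(m+1)) (k+t+2)^a`.  It is an open conjecture and is NOT refuted here.
What is certified (elementary, from Descartes' expansion bound `2kt^m − 1`, tree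
`card_roots_toFinset_sumProd_sparse_le`, and the witnesses `∏_{i<N} (X − i)`):

* `realTauRefined_iff_without_ne_zero` — the hypothesis `F ≠ 0` is decoration (`roots 0 = 0`);
* `realTauRefined_bound_fails_at_zero` — the body at exponent `a = 0` is false (witness `X(X−1)`), and
  `realTauRefined_hyps_satisfiable` — the hypotheses are met non-degenerately;
* any proof must USE each ingredient of the bound — the refuted VARIANTS are inlined in the `¬ (…)`
  statements (inner block = the crux's, verbatim, with one ingredient removed):
  `realTauRefined_false_without_sparsity` (drop `#supp f_ij ≤ t`), `realTauRefined_false_without_pow_m`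
  (drop the factor `2^(a(m+1))`), `realTauRefined_false_without_k` (drop `k` from the base);
* the quantifier-SWAPPED weakenings are already theorems, so `∃ a` first is the whole content:
  `realTauRefined_forall_m_exists_a`, `realTauRefined_forall_t_exists_a` (Descartes), and the binomial
  case `realTauRefined_case_t_le_two` (`a = 1`).
No facts and no `def`s: witnesses are built inside the proofs. [folklore]
-/

set_option linter.dupNamespace false

namespace Summit.ValiantsHypothesis.ValiantsHypothesis.Theorems.RealTauRefined.Negative

open Polynomial Finset
open Literature.Computability.AlgebraicComplexity
open Summit.ValiantsHypothesis.ValiantsHypothesis.Theses.RealTau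


/-! ### (e) the `≠ 0` hypothesis is decoration -/

/-- `F ≠ 0` is decoration: `Polynomial.roots 0 = 0`. [folklore] -/
theorem realTauRefined_iff_without_ne_zero : RealTauRefined ↔
    (∃ a : ℕ, ∀ (k m t : ℕ) (f : Fin k → Fin m → Polynomial ℝ),
      (∀ i j, (f i j).support.card ≤ t) →
        (∑ i, ∏ j, f i j).roots.toFinset.card ≤ 2 ^ (a * (m + 1)) * (k + t + 2) ^ a) := by
  constructor
  · rintro ⟨a, ha⟩
    refine ⟨a, fun k m t f hf => ?_⟩
    by_cases hF : (∑ i, ∏ j, f i j) = 0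
    · simp [hF]
    · exact ha k m t f hf hF
  · rintro ⟨a, ha⟩
    exact ⟨a, fun k m t f hf _ => ha k m t f hf⟩

/-! ### (b) the exponent `a = 0` fails -/

/-- Non-vacuity: the hypotheses of the crux are met by a non-degenerate instance with real zeros
(`k = m = 1`, `t = 3`, `F = X(X-1)`). [folklore] -/
theorem realTauRefined_hyps_satisfiable :
    ∃ (k m t : ℕ) (f : Fin k → Fin m → Polynomial ℝ),
      (∀ i j, (f i j).support.card ≤ t) ∧ (∑ i, ∏ j, f i j) ≠ 0 ∧
        0 < (∑ i, ∏ j, f i j).roots.toFinset.card := by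
  set s : Multiset ℝ := (Multiset.range 2).map ((↑) : ℕ → ℝ) with hs
  set P : Polynomial ℝ := (s.map fun r => X - C r).prod with hP
  have hnd : s.Nodup := (Multiset.nodup_range 2).map Nat.cast_injective
  have hsN : Multiset.card s = 2 := by rw [hs, Multiset.card_map, Multiset.card_range]
  have hcard : P.roots.toFinset.card = 2 := by
    rw [hP, roots_multiset_prod_X_sub_C, Multiset.toFinset_card_of_nodup hnd, hsN]
  have hP0 : P ≠ 0 := by
    rw [hP]; exact (monic_multiset_prod_of_monic _ _ fun r _ => monic_X_sub_C r).ne_zero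
  have hsupp : P.support.card ≤ 3 := by
    have hdeg : P.natDegree = 2 := by rw [hP, natDegree_multiset_prod_X_sub_C_eq_card, hsN]
    exact (card_supp_le_succ_natDegree P).trans (by rw [hdeg])
  have key : (∑ _i : Fin 1, ∏ _j : Fin 1, P) = P := by simp
  refine ⟨1, 1, 3, fun _ _ => P, fun _ _ => hsupp, ?_, ?_⟩
  · rw [key]; exact hP0
  · rw [key, hcard]; norm_num

/-- Tightness at the bottom: the body of `RealTauRefined` at `a = 0` (bound `≡ 1`) is false,
witness `X(X-1)` (`k = m = 1`, `t = 3`). [folklore] -/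
theorem realTauRefined_bound_fails_at_zero :
    ¬ ∀ (k m t : ℕ) (f : Fin k → Fin m → Polynomial ℝ),
      (∀ i j, (f i j).support.card ≤ t) → (∑ i, ∏ j, f i j) ≠ 0 →
        (∑ i, ∏ j, f i j).roots.toFinset.card ≤ 2 ^ (0 * (m + 1)) * (k + t + 2) ^ 0 := by
  intro ha
  set s : Multiset ℝ := (Multiset.range 2).map ((↑) : ℕ → ℝ) with hs
  set P : Polynomial ℝ := (s.map fun r => X - C r).prod with hP
  have hnd : s.Nodup := (Multiset.nodup_range 2).map Nat.cast_injective
  have hsN : Multiset.card s = 2 := by rw [hs, Multiset.card_map, Multiset.card_range]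
  have hcard : P.roots.toFinset.card = 2 := by
    rw [hP, roots_multiset_prod_X_sub_C, Multiset.toFinset_card_of_nodup hnd, hsN]
  have hP0 : P ≠ 0 := by
    rw [hP]; exact (monic_multiset_prod_of_monic _ _ fun r _ => monic_X_sub_C r).ne_zero
  have hsupp : P.support.card ≤ 3 := by
    have hdeg : P.natDegree = 2 := by rw [hP, natDegree_multiset_prod_X_sub_C_eq_card, hsN]
    exact (card_supp_le_succ_natDegree P).trans (by rw [hdeg])
  have key : (∑ _i : Fin 1, ∏ _j : Fin 1, P) = P := by simp
  have h := ha 1 1 3 (fun _ _ => P) (fun _ _ => hsupp) (by rw [key]; exact hP0)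
  rw [key, hcard] at h
  norm_num at h

/-! ### (a) load-bearing analysis -/

/-- Any proof must use sparsity: without it, `∏_{i<N} (X - i)` (`k = m = 1`, `t = 0`,
`N = 4^a 3^a + 1`) breaks every exponent `a`. [folklore] -/
theorem realTauRefined_false_without_sparsity :
    ¬ (∃ a : ℕ, ∀ (k m t : ℕ) (f : Fin k → Fin m → Polynomial ℝ), (∑ i, ∏ j, f i j) ≠ 0 →
        (∑ i, ∏ j, f i j).roots.toFinset.card ≤ 2 ^ (a * (m + 1)) * (k + t + 2) ^ a) := by
  rintro ⟨a, ha⟩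
  set N : ℕ := 2 ^ (a * (1 + 1)) * (1 + 0 + 2) ^ a + 1 with hN
  set s : Multiset ℝ := (Multiset.range N).map ((↑) : ℕ → ℝ) with hs
  set P : Polynomial ℝ := (s.map fun r => X - C r).prod with hP
  have hnd : s.Nodup := (Multiset.nodup_range N).map Nat.cast_injective
  have hcard : P.roots.toFinset.card = N := by
    rw [hP, roots_multiset_prod_X_sub_C, Multiset.toFinset_card_of_nodup hnd, hs,
      Multiset.card_map, Multiset.card_range]
  have hP0 : P ≠ 0 := by
    rw [hP]; exact (monic_multiset_prod_of_monic _ _ fun r _ => monic_X_sub_C r).ne_zero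
  have h := ha 1 1 0 (fun _ _ => P) (by simpa using hP0)
  have key : (∑ _i : Fin 1, ∏ _j : Fin 1, P) = P := by simp
  rw [key, hcard] at h
  omega

/-- Any proof must let the bound grow with `m`: one product of `m` binomials `∏_{j<m} (X - j)`
(`k = 1`, `t = 2`, `m = 5^a + 1`) has `m` distinct real zeros. [folklore] -/
theorem realTauRefined_false_without_pow_m :
    ¬ (∃ a : ℕ, ∀ (k m t : ℕ) (f : Fin k → Fin m → Polynomial ℝ),
        (∀ i j, (f i j).support.card ≤ t) → (∑ i, ∏ j, f i j) ≠ 0 →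
          (∑ i, ∏ j, f i j).roots.toFinset.card ≤ (k + t + 2) ^ a) := by
  rintro ⟨a, ha⟩
  set N : ℕ := (1 + 2 + 2) ^ a + 1 with hN
  have hprod : (∏ j : Fin N, (X - C ((j : ℕ) : ℝ))) =
      (((Multiset.range N).map ((↑) : ℕ → ℝ)).map fun r => X - C r).prod := by
    rw [Fin.prod_univ_eq_prod_range (fun i : ℕ => X - C (i : ℝ)) N, Finset.prod_eq_multiset_prod,
      Finset.range_val, Multiset.map_map]
    rfl
  have hnd : ((Multiset.range N).map ((↑) : ℕ → ℝ)).Nodup :=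
    (Multiset.nodup_range N).map Nat.cast_injective
  have hcard : (∏ j : Fin N, (X - C ((j : ℕ) : ℝ))).roots.toFinset.card = N := by
    rw [hprod, roots_multiset_prod_X_sub_C, Multiset.toFinset_card_of_nodup hnd, Multiset.card_map,
      Multiset.card_range]
  have hne : (∏ j : Fin N, (X - C ((j : ℕ) : ℝ))) ≠ 0 := by
    rw [hprod]; exact (monic_multiset_prod_of_monic _ _ fun r _ => monic_X_sub_C r).ne_zero
  have hsupp : ∀ j : Fin N, (X - C ((j : ℕ) : ℝ)).support.card ≤ 2 := fun j =>
    (card_supp_le_succ_natDegree _).trans (by rw [natDegree_X_sub_C])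
  have key : (∑ _i : Fin 1, ∏ j : Fin N, (X - C ((j : ℕ) : ℝ))) =
      ∏ j : Fin N, (X - C ((j : ℕ) : ℝ)) := by simp
  have h := ha 1 N 2 (fun _ j => X - C ((j : ℕ) : ℝ)) (fun _ j => hsupp j) (by rw [key]; exact hne)
  rw [key, hcard] at h
  omega

/-- Any proof must let the bound grow with `k`: `∏_{i<N} (X - i)` written monomial by monomial is a
sum of `k = N + 1` products of `m = 1` polynomial with `t = 1` monomial (`N = 12^a + 1`). [folklore] -/
theorem realTauRefined_false_without_k :
    ¬ (∃ a : ℕ, ∀ (k m t : ℕ) (f : Fin k → Fin m → Polynomial ℝ),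
        (∀ i j, (f i j).support.card ≤ t) → (∑ i, ∏ j, f i j) ≠ 0 →
          (∑ i, ∏ j, f i j).roots.toFinset.card ≤ 2 ^ (a * (m + 1)) * (t + 2) ^ a) := by
  rintro ⟨a, ha⟩
  set N : ℕ := 2 ^ (a * (1 + 1)) * (1 + 2) ^ a + 1 with hN
  set s : Multiset ℝ := (Multiset.range N).map ((↑) : ℕ → ℝ) with hs
  set P : Polynomial ℝ := (s.map fun r => X - C r).prod with hP
  have hnd : s.Nodup := (Multiset.nodup_range N).map Nat.cast_injective
  have hsN : Multiset.card s = N := by rw [hs, Multiset.card_map, Multiset.card_range]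
  have hcard : P.roots.toFinset.card = N := by
    rw [hP, roots_multiset_prod_X_sub_C, Multiset.toFinset_card_of_nodup hnd, hsN]
  have hP0 : P ≠ 0 := by
    rw [hP]; exact (monic_multiset_prod_of_monic _ _ fun r _ => monic_X_sub_C r).ne_zero
  have hdeg : P.natDegree = N := by
    rw [hP, natDegree_multiset_prod_X_sub_C_eq_card, hsN]
  have key : (∑ i : Fin (N + 1), ∏ _j : Fin 1, C (P.coeff (i : ℕ)) * X ^ (i : ℕ)) = P := by
    simp only [Finset.prod_const, Finset.card_univ, Fintype.card_fin, pow_one]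
    rw [Fin.sum_univ_eq_sum_range (fun i => C (P.coeff i) * X ^ i) (N + 1), ← hdeg]
    exact (as_sum_range_C_mul_X_pow P).symm
  have h := ha (N + 1) 1 1 (fun i _ => C (P.coeff (i : ℕ)) * X ^ (i : ℕ))
    (fun _ _ => card_support_C_mul_X_pow_le_one) (by rw [key]; exact hP0)
  rw [key, hcard] at h
  omega

/-! ### (c) weakenings that are already theorems -/

/-- Quantifier order is essential: with `a` depending on `m`, Descartes' bound suffices.
[cite: Koiran2011, §6 p. 317 (bound 2kt^m - 1)] -/
theorem realTauRefined_forall_m_exists_a :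
    ∀ m : ℕ, ∃ a : ℕ, ∀ (k t : ℕ) (f : Fin k → Fin m → Polynomial ℝ),
      (∀ i j, (f i j).support.card ≤ t) → (∑ i, ∏ j, f i j) ≠ 0 →
        (∑ i, ∏ j, f i j).roots.toFinset.card ≤ 2 ^ (a * (m + 1)) * (k + t + 2) ^ a := by
  intro m
  refine ⟨m + 1, fun k t f hf hF => ?_⟩
  have h := card_roots_toFinset_sumProd_sparse_le f hf hF
  have h1 : k * t ^ m ≤ (k + t + 2) ^ (m + 1) := by
    rw [pow_succ']
    exact Nat.mul_le_mul (by omega) (Nat.pow_le_pow_left (by omega) m)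
  have h2 : 2 ≤ 2 ^ ((m + 1) * (m + 1)) :=
    calc (2 : ℕ) = 2 ^ 1 := by norm_num
      _ ≤ 2 ^ ((m + 1) * (m + 1)) := Nat.pow_le_pow_right (by norm_num) (by nlinarith)
  calc _ ≤ 2 * (k * t ^ m) - 1 := h
    _ ≤ 2 * (k * t ^ m) := Nat.sub_le _ _
    _ ≤ 2 ^ ((m + 1) * (m + 1)) * (k + t + 2) ^ (m + 1) := Nat.mul_le_mul h2 h1

/-- Quantifier order is essential: with `a` depending on `t`, Descartes' bound suffices too.
[cite: Koiran2011, §6 p. 317 (bound 2kt^m - 1)] -/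
theorem realTauRefined_forall_t_exists_a :
    ∀ t : ℕ, ∃ a : ℕ, ∀ (k m : ℕ) (f : Fin k → Fin m → Polynomial ℝ),
      (∀ i j, (f i j).support.card ≤ t) → (∑ i, ∏ j, f i j) ≠ 0 →
        (∑ i, ∏ j, f i j).roots.toFinset.card ≤ 2 ^ (a * (m + 1)) * (k + t + 2) ^ a := by
  intro t
  refine ⟨t + 1, fun k m f hf hF => ?_⟩
  have h := card_roots_toFinset_sumProd_sparse_le f hf hF
  have ht2 : t ^ m ≤ 2 ^ (t * m) := by
    rw [pow_mul]; exact Nat.pow_le_pow_left (Nat.lt_two_pow_self).le m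
  have h2 : 2 * t ^ m ≤ 2 ^ ((t + 1) * (m + 1)) :=
    calc 2 * t ^ m ≤ 2 * 2 ^ (t * m) := Nat.mul_le_mul_left 2 ht2
      _ = 2 ^ (t * m + 1) := (pow_succ' 2 (t * m)).symm
      _ ≤ 2 ^ ((t + 1) * (m + 1)) := Nat.pow_le_pow_right (by norm_num) (by nlinarith)
  have hk : k ≤ (k + t + 2) ^ (t + 1) :=
    calc k ≤ k + t + 2 := by omega
      _ ≤ (k + t + 2) ^ (t + 1) := Nat.le_self_pow (by omega) _
  calc _ ≤ 2 * (k * t ^ m) - 1 := h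
    _ ≤ 2 * (k * t ^ m) := Nat.sub_le _ _
    _ = (2 * t ^ m) * k := by ring
    _ ≤ 2 ^ ((t + 1) * (m + 1)) * (k + t + 2) ^ (t + 1) := Nat.mul_le_mul h2 hk

/-- Cheap special case: binomial inputs (`t ≤ 2`) satisfy the bound with `a = 1`.
[cite: Koiran2011, §6 p. 317 (bound 2kt^m - 1)] -/
theorem realTauRefined_case_t_le_two (k m t : ℕ) (ht : t ≤ 2) (f : Fin k → Fin m → Polynomial ℝ)
    (hf : ∀ i j, (f i j).support.card ≤ t) (hF : (∑ i, ∏ j, f i j) ≠ 0) :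
    (∑ i, ∏ j, f i j).roots.toFinset.card ≤ 2 ^ (1 * (m + 1)) * (k + t + 2) ^ 1 := by
  have h := card_roots_toFinset_sumProd_sparse_le f hf hF
  have htm : t ^ m ≤ 2 ^ m := Nat.pow_le_pow_left ht m
  calc _ ≤ 2 * (k * t ^ m) - 1 := h
    _ ≤ 2 * (k * t ^ m) := Nat.sub_le _ _
    _ ≤ 2 * (k * 2 ^ m) := by gcongr
    _ = 2 ^ (1 * (m + 1)) * k := by ring
    _ ≤ 2 ^ (1 * (m + 1)) * (k + t + 2) ^ 1 := by
        rw [pow_one]; exact Nat.mul_le_mul_left _ (by omega)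

end Summit.ValiantsHypothesis.ValiantsHypothesis.Theorems.RealTauRefined.Negative
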